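import Mathlib
import HarnessLib
import HarnessLib.Audit
import Summits.ValiantsHypothesis.ValiantsHypothesis.Theorems.LacunarySymmetroidMatrixDescartesZeroChangeConcavityBudgetPureT5
import Summits.ValiantsHypothesis.ValiantsHypothesis.Theorems.LacunarySymmetroidMatrixDescartesZeroChangeConcavityBudgetRise

/-!
# ValiantsHypothesis / LacunarySymmetroid — crux `MatrixDescartes` (stmt-ValiantsHypothesis-18050, V1), LINE (A) «product_plus_one»:
# ONE KNEE PER ROW — past its root a `(+,−,−)` row's push rises monotonically inside `(a, c)` once it starts rising

Twelfth part of the concavity budget (✓ `…Riccati`, ✓ `…Rise`).  For a `(+,−,−)` row `g = a₀ + a₁t^a + a₂t^c` (`a₀ > 0 ≥ a₁, a₂`,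
`0 < a < c`) and its push `u(t) = t g′(t)/g(t)` past the root (`g(t) < 0`):

* `logDeriv_gt_bottom_of_neg` — `u(t) > a` (exported from the proof of ✓ `pureT5_dip_early`);
* `eval_row_neg_of_le` — past the root stays past the root: `g(t₁) < 0`, `t₁ ≤ t₂` ⇒ `g(t₂) < 0`;
* ★ `logDeriv_monotoneOn_of_rowWronskian_nonneg` — if the row Wronskian is `≥ 0` at `t₁` (the push has started to rise) then `u` is
  MONOTONE on `[t₁, ∞)` (✓ `rowWronskian_nonneg_persist` + `t·u′ = W/g²` + the mean value theorem);
* ★ `logDeriv_rise_window` — consequently for `t₁ ≤ t₂`: `a < u(t₁) ≤ u(t₂) < c`.  The total rise of a row's push after its knee is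
  `< c − a`: the per-row RISE BUDGET of the dip mechanism in kernel form (NOTE rev 3: every dip of a window is paid for by rises of
  switched pushes, `A(z_{k+1}) − A(z_k) = B(z_{k+1}) − B(z_k) > 0`).

HONEST FRAMING: per-row calculus, def-free, no named facts, no sorry, standard axioms; closes NO stub by name; `OneChangeFloorK3`,
`MatrixDescartes` (stmt-ValiantsHypothesis-18050) OPEN; `VP ≠ VNP` is NOT proved and nothing here bears on it.

[folklore] Elementary calculus (mean value theorem); no citation needed.
-/

set_option linter.dupNamespace false

namespace Summit.ValiantsHypothesis.ValiantsHypothesis.Theorems.LacunarySymmetroidMatrixDescartes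

namespace ZeroChange

open Polynomial

/-- Past the root of a row with `a₀ > 0`, `a₂ ≤ 0` (`0 < a < c`, `t > 0`, `g(t) < 0`): the push exceeds the bottom exponent, `u(t) > a`. -/
theorem logDeriv_gt_bottom_of_neg (a c : ℕ) (ha : 0 < a) (hac : a < c) {a₀ a₁ a₂ : ℝ} (h₀ : 0 < a₀) (h₂ : a₂ ≤ 0)
    {t : ℝ} (ht : 0 < t) (hg : (row a c a₀ a₁ a₂).eval t < 0) :
    (a : ℝ) < t * (derivative (row a c a₀ a₁ a₂)).eval t / (row a c a₀ a₁ a₂).eval t := by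
  have ha' : (0 : ℝ) < a := by exact_mod_cast ha
  have hca : (0 : ℝ) ≤ (c : ℝ) - a := by
    have : (a : ℝ) < c := by exact_mod_cast hac
    linarith
  have hγ : a₂ * t ^ c ≤ 0 := mul_nonpos_iff.2 (Or.inr ⟨h₂, (pow_pos ht c).le⟩)
  rw [mul_eval_derivative_row, lt_div_iff_of_neg hg, eval_row]
  nlinarith [mul_nonpos_iff.2 (Or.inl ⟨hca, hγ⟩), mul_pos ha' h₀]

/-- A `(+,−,−)` row stays negative to the right of any point where it is negative (it is non-increasing on `(0,∞)`). -/
theorem eval_row_neg_of_le (a c : ℕ) (ha : 0 < a) (hac : a < c) {a₀ a₁ a₂ : ℝ} (h₁ : a₁ ≤ 0) (h₂ : a₂ ≤ 0)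
    {t₁ t₂ : ℝ} (ht₁ : 0 < t₁) (h12 : t₁ ≤ t₂) (hg : (row a c a₀ a₁ a₂).eval t₁ < 0) :
    (row a c a₀ a₁ a₂).eval t₂ < 0 := by
  rcases eq_or_lt_of_le h12 with heq | hlt
  · rw [← heq]; exact hg
  by_cases hqs : a₁ < 0 ∨ a₂ < 0
  · exact (eval_row_lt_of_pureT5 a c ha hac (p := a₀) h₁ h₂ hqs ht₁ hlt).trans hg
  · -- both letters vanish: the row is the constant `a₀`, negative at `t₁`, hence at `t₂`
    have h1z : a₁ = 0 := le_antisymm h₁ (not_lt.1 fun h => hqs (Or.inl h))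
    have h2z : a₂ = 0 := le_antisymm h₂ (not_lt.1 fun h => hqs (Or.inr h))
    rw [eval_row] at hg ⊢
    rw [h1z, h2z] at hg ⊢
    simpa using hg

/-- ★ **One knee**: for a `(+,−,−)` row (`a₀ ≥ 0 ≥ a₁, a₂`, `0 < a < c`), if `g(t₁) < 0` and the row Wronskian is nonnegative at
`t₁ > 0`, then the push `u = t g′/g` is monotone on `[t₁, ∞)`. -/
theorem logDeriv_monotoneOn_of_rowWronskian_nonneg (a c : ℕ) (ha : 0 < a) (hac : a < c) {a₀ a₁ a₂ : ℝ}
    (h₀ : 0 ≤ a₀) (h₁ : a₁ ≤ 0) (h₂ : a₂ ≤ 0) {t₁ : ℝ} (ht₁ : 0 < t₁) (hg : (row a c a₀ a₁ a₂).eval t₁ < 0)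
    (hW : 0 ≤ (a : ℝ) ^ 2 * a₀ * a₁ * t₁ ^ a + (c : ℝ) ^ 2 * a₀ * a₂ * t₁ ^ c + ((c : ℝ) - a) ^ 2 * a₁ * a₂ * t₁ ^ (a + c)) :
    MonotoneOn (fun x => x * (derivative (row a c a₀ a₁ a₂)).eval x / (row a c a₀ a₁ a₂).eval x) (Set.Ici t₁) := by
  have hneg : ∀ x ∈ Set.Ici t₁, (row a c a₀ a₁ a₂).eval x < 0 := fun x hx => eval_row_neg_of_le a c ha hac h₁ h₂ ht₁ hx hg
  refine monotoneOn_of_deriv_nonneg (convex_Ici t₁) ?_ ?_ ?_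
  · -- continuity on `[t₁, ∞)`: a quotient of polynomial functions with non-vanishing denominator
    refine ContinuousOn.div ?_ ?_ fun x hx => (hneg x hx).ne
    · exact (continuous_id.mul (derivative (row a c a₀ a₁ a₂)).continuous).continuousOn
    · exact (row a c a₀ a₁ a₂).continuous.continuousOn
  · intro x hx
    rw [interior_Ici] at hx
    obtain ⟨u', hu', -⟩ := t_mul_deriv_logDeriv_eq a c a₀ a₁ a₂ (hneg x (Set.mem_Ici.2 (le_of_lt hx))).ne
    exact hu'.differentiableAt.differentiableWithinAt
  · intro x hx
    rw [interior_Ici] at hx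
    have hx' : t₁ < x := hx
    have hxpos : 0 < x := ht₁.trans hx'
    obtain ⟨u', hu', hxu'⟩ := t_mul_deriv_logDeriv_eq a c a₀ a₁ a₂ (hneg x (Set.mem_Ici.2 hx'.le)).ne
    rw [hu'.deriv]
    have hWx := rowWronskian_nonneg_persist a c hac.le h₀ h₁ h₂ ht₁ hx'.le hW
    have hq : 0 ≤ x * u' := by
      rw [hxu']
      exact div_nonneg hWx (sq_nonneg _)
    nlinarith [hq, hxpos]

/-- ★ **The rise happens inside `(a, c)`**: under the hypotheses of the knee lemma with `a₀ > 0`, for every `t₂ ≥ t₁`: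
`a < u(t₁) ≤ u(t₂) < c`.  The total rise of a `(+,−,−)` row's push after its knee is less than `c − a`. -/
theorem logDeriv_rise_window (a c : ℕ) (ha : 0 < a) (hac : a < c) {a₀ a₁ a₂ : ℝ}
    (h₀ : 0 < a₀) (h₁ : a₁ ≤ 0) (h₂ : a₂ ≤ 0) {t₁ t₂ : ℝ} (ht₁ : 0 < t₁) (h12 : t₁ ≤ t₂)
    (hg : (row a c a₀ a₁ a₂).eval t₁ < 0)
    (hW : 0 ≤ (a : ℝ) ^ 2 * a₀ * a₁ * t₁ ^ a + (c : ℝ) ^ 2 * a₀ * a₂ * t₁ ^ c + ((c : ℝ) - a) ^ 2 * a₁ * a₂ * t₁ ^ (a + c)) :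
    (a : ℝ) < t₁ * (derivative (row a c a₀ a₁ a₂)).eval t₁ / (row a c a₀ a₁ a₂).eval t₁ ∧
    t₁ * (derivative (row a c a₀ a₁ a₂)).eval t₁ / (row a c a₀ a₁ a₂).eval t₁ ≤
      t₂ * (derivative (row a c a₀ a₁ a₂)).eval t₂ / (row a c a₀ a₁ a₂).eval t₂ ∧
    t₂ * (derivative (row a c a₀ a₁ a₂)).eval t₂ / (row a c a₀ a₁ a₂).eval t₂ < (c : ℝ) := by
  have ht₂ : 0 < t₂ := lt_of_lt_of_le ht₁ h12
  have hg₂ : (row a c a₀ a₁ a₂).eval t₂ < 0 := eval_row_neg_of_le a c ha hac h₁ h₂ ht₁ h12 hg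
  refine ⟨logDeriv_gt_bottom_of_neg a c ha hac h₀ h₂ ht₁ hg, ?_, ?_⟩
  · exact logDeriv_monotoneOn_of_rowWronskian_nonneg a c ha hac h₀.le h₁ h₂ ht₁ hg hW
      (Set.mem_Ici.2 le_rfl) (Set.mem_Ici.2 h12) h12
  · exact logDeriv_lt_top_of_rowWronskian_nonneg a c ha hac h₀ h₁ h₂ ht₂ hg₂
      (rowWronskian_nonneg_persist a c hac.le h₀.le h₁ h₂ ht₁ h12 hW)

end ZeroChange

end Summit.ValiantsHypothesis.ValiantsHypothesis.Theorems.LacunarySymmetroidMatrixDescartes
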